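import Mathlib
import Summits.MatrixMultiplication.MatrixMultiplication.Theses.MatrixPointInterpolation
import Summits.MatrixMultiplication.MatrixMultiplication.Theorems.MatrixPointInterpolationWindowedKaplanskyCapelli
import Summits.MatrixMultiplication.MatrixMultiplication.Theorems.MatrixPointInterpolationTightWindowsStubFibreDensity
import Summits.MatrixMultiplication.MatrixMultiplication.Theorems.TightWindows.Negative.WindowDimUnbounded
import Summits.MatrixMultiplication.MatrixMultiplication.Theorems.TightWindows.Negative.ShiftCornerMasquerade

/-!
# `TightWindows` (stmt-MatrixMultiplication-18939), line `shirshov-split`: the registered stub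
# `stub_coreGeFour` is FALSE (already at order `K = 4`, point size `5`)

The window-free core of Branch II at point sizes `k = K + 1 ≥ 4` claims that no large generating
pair carries a level `L` with a non-`(K+1)`-algebraic element and all `K + 2` fibre sums of the
Cayley–Hamilton–Capelli polynomial vanishing within budget.  At `K = 4` the shift / corner pair
`A = (N, E_{m,0})` of `M_{m+1}(ℂ)`, `d = 2m + 1`, `L = 1`, is a counterexample for every `m ≥ 5`:
it generates in degree `d ≤ 2n` (`TightWindowsNeg.shiftPair_gen`), it MASQUERADES as `M_5` to
degree `2d` (`TightWindowsNeg.shiftPair_masq`, p158963), `Y₀ = N ∈ V_1` has independent powers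
`1, N, …, N^5` (`m ≥ 5`), so the LANDED fibre-density stub (`TightWindows.stub_fibreDensity`,
p155914) hands over exactly the fibre hypotheses of `stub_coreGeFour` — whose conclusion is
`False`.  (Consistent with the refutation of the crux itself,
`MatrixPointInterpolationTightWindows_refuted`: the composition `TightWindows_of_stubs` of the line
cannot have all its stubs true.)
-/

set_option linter.dupNamespace false
-- `MatrixMultiplication.MatrixMultiplication` is the summit/sub-problem path (D-0017)

namespace Summit.MatrixMultiplication.MatrixMultiplication.Theorems

namespace TightWindowsNeg

open scoped BigOperators

/-- The powers `1, N, …, N^5` of the shift of `M_{m+1}(ℂ)` are linearly independent for `m ≥ 5`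
(row `0` of `N^j` is `e_j`). [folklore] -/
theorem linearIndependent_shift_pow {m : ℕ} (hm : 5 ≤ m) (N : Matrix (Fin (m + 1)) (Fin (m + 1)) ℂ)
    (hN : ∀ i j : Fin (m + 1), N i j = if (j : ℕ) = (i : ℕ) + 1 then 1 else 0) :
    LinearIndependent ℂ (fun j : Fin (4 + 2) => N ^ (j : ℕ)) := by
  rw [Fintype.linearIndependent_iff]
  intro g hg j
  have hj : (j : ℕ) < m + 1 := by have := j.isLt; omega
  have h := congr_fun (congr_fun hg 0) ⟨j, hj⟩
  rw [Matrix.sum_apply, Matrix.zero_apply] at h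
  simp only [Matrix.smul_apply, shiftMat_pow_apply N hN, smul_eq_mul, Fin.val_zero, zero_add,
    mul_ite, mul_one, mul_zero] at h
  rw [Finset.sum_eq_single j] at h
  · simpa using h
  · intro i _ hi
    rw [if_neg]
    intro e
    exact hi (Fin.ext e).symm
  · intro habs
    exact absurd (Finset.mem_univ _) habs

/-- **`stub_coreGeFour` (line `shirshov-split`, skeleton `Cruxes/TightWindows/Lines/
shirshov_split.lean`) is false**, at `K = 4`, `C = 2`: the shift / corner masquerade of `M_5`
satisfies all its hypotheses (generation, a non-`5`-algebraic `Y₀ = N ∈ V_1`, and the fibre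
identities through the landed `stub_fibreDensity`) at every size `m + 1 ≥ n₀`. [folklore] -/
theorem stub_coreGeFour_false : ¬ (∀ K : ℕ, 3 ≤ K → ∀ C : ℕ, ∃ n₀ : ℕ,
    ∀ (n d L : ℕ) (A : Fin 2 → Matrix (Fin n) (Fin n) ℂ), n₀ ≤ n → d ≤ C * n → 1 ≤ L →
    L ≤ 2 * (K + 1) ^ 2 + 1 →
    Submodule.span ℂ {M : Matrix (Fin n) (Fin n) ℂ |
      ∃ w : List (Fin 2), w.length ≤ d ∧ (w.map A).prod = M} = ⊤ →
    (∃ Y₀ ∈ Masquerade.wordSpan A L, LinearIndependent ℂ (fun j : Fin (K + 2) => Y₀ ^ (j : ℕ))) →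
    (∀ (e : Fin K → ℕ), L * ((K + 1) * (K + 2) / 2) + d + ∑ i, e i ≤ 2 * d →
      ∀ Y ∈ Masquerade.wordSpan A L, ∀ (Z' : Fin K → Matrix (Fin n) (Fin n) ℂ),
      (∀ i, Z' i ∈ Masquerade.wordSpan A (e i)) →
      ∀ p : Fin (K + 2), Masquerade.capRest K Y Z' p = 0) → False) := by
  intro h
  obtain ⟨n₀, hn₀⟩ := h 4 (by norm_num) 2
  obtain ⟨m, hm5, hmn⟩ : ∃ m : ℕ, 5 ≤ m ∧ n₀ ≤ m + 1 := ⟨max n₀ 5, le_max_right _ _,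
    (le_max_left _ _).trans (Nat.le_succ _)⟩
  set N : Matrix (Fin (m + 1)) (Fin (m + 1)) ℂ :=
    Matrix.of fun i j : Fin (m + 1) => if (j : ℕ) = (i : ℕ) + 1 then (1 : ℂ) else 0 with hNdef
  have hN : ∀ i j : Fin (m + 1), N i j = if (j : ℕ) = (i : ℕ) + 1 then 1 else 0 := fun _ _ => rfl
  have hgen := shiftPair_gen N hN (d := 2 * m + 1) le_rfl
  have hmasq := shiftPair_masq N hN
  set A : Fin 2 → Matrix (Fin (m + 1)) (Fin (m + 1)) ℂ := ![N, Matrix.single (Fin.last m) 0 1]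
    with hA
  have hNmem : N ∈ Masquerade.wordSpan A 1 := by
    simpa [hA] using Masquerade.gen_mem_wordSpan A (L := 1) le_rfl 0
  have hY₀ : ∃ Y₀ ∈ Masquerade.wordSpan A 1,
      LinearIndependent ℂ (fun j : Fin (4 + 2) => Y₀ ^ (j : ℕ)) :=
    ⟨N, hNmem, linearIndependent_shift_pow hm5 N hN⟩
  have hfib := TightWindows.stub_fibreDensity 4 1 (m + 1) (2 * m + 1) A hgen hmasq hY₀
  exact hn₀ (m + 1) (2 * m + 1) 1 A hmn (by omega) le_rfl (by norm_num) hgen hY₀ hfib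

end TightWindowsNeg

end Summit.MatrixMultiplication.MatrixMultiplication.Theorems
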